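import Mathlib
import Summits.RiemannHypothesis.RiemannHypothesis.Theorems.DensityLadderSeparatedTowerTransform
import Summits.RiemannHypothesis.RiemannHypothesis.Theorems.DensityLadderSeparatedTowerTransformDecay
import Summits.RiemannHypothesis.RiemannHypothesis.Theorems.DensityLadderSeparatedTowerGaussian
import Summits.RiemannHypothesis.RiemannHypothesis.Theorems.DensityLadderSeparatedTowerGaussianReal
import Summits.RiemannHypothesis.RiemannHypothesis.Theorems.DensityLadderSeparatedTowerWindows
import Summits.RiemannHypothesis.RiemannHypothesis.Theorems.DensityLadderSeparatedTowerSchur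
import Summits.RiemannHypothesis.RiemannHypothesis.Theorems.DensityLadderSeparatedTowerTameFinite
import Summits.RiemannHypothesis.RiemannHypothesis.Theorems.DensityLadderSeparatedTowerUpperPieces
import Summits.RiemannHypothesis.RiemannHypothesis.Theorems.DensityLadderSeparatedTowerFarTail
import Summits.RiemannHypothesis.RiemannHypothesis.Theorems.DensityLadderSeparatedTowerUpperPointwise
import HarnessLib

/-!
# `DensityLadder.SeparatedTowerDensityLine` (item stmt-RiemannHypothesis-24918) — the UPPER half of
# stub S1: `∫ |Z_F|² G ≪ A² log² A`

LINE L57 «sieve sight above the density line» (rh-idea-10 g1), crux K1 `SeparatedTowerDensityLine`,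
stub S1; assembly skeleton `S1-ASSEMBLY-SKELETON.lean` on stmt-RiemannHypothesis-24918 (its only
remaining sub-goal is exactly `upper_bound` below).  With `A = 4(T+1)`, `η = 1/A`, `U = log A`,
`L = 2/g`, `F` the tower zeros of height `≤ T⁴` and `Z_F(u) = Σ_{i∈F} m_i ĉ_i e^{ρ_i u}`:
for `u ≥ log 3` the explicit-formula bound `‖S(e^u)‖ ≤ C_a(e^u u + A u)` and the decomposition
`S = Z_F + Z_A + (far tail)` give `‖Z_F‖ ≤ C_a(e^u u + Au) + ‖Z_A‖ + e^u C_R`; for `u < log 3`,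
`‖Z_F‖ ≤ 3 Σ_F m‖ĉ‖ ≪ A`.  Integrating the resulting majorant against `G_L(u−U)` with the real
Gaussian moments, the finite mean-square expansion of `Z_A` and the tame unit-window Schur bound
yields `∫ ‖Z_F‖² G ≤ C_up A² U²` (the pointwise majorant and the tame mean square are the two
lemmas of `…SeparatedTowerUpperPointwise`).
Cell rh-split, seat prover-l57 g0.  RH-free, ζ-free; FRONTIER bookkeeping; nothing here bears on RH.
-/

set_option linter.dupNamespace false
set_option maxHeartbeats 1600000

noncomputable section

open Complex Filter Set MeasureTheory Topology Finset
open scoped Real ComplexConjugate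

namespace Summit.RiemannHypothesis.RiemannHypothesis.Theorems.DensityLadderSeparatedTowerUpperBound

open Summit.RiemannHypothesis.RiemannHypothesis.Theorems.DensityLadderSeparatedTowerTransform
open Summit.RiemannHypothesis.RiemannHypothesis.Theorems.DensityLadderSeparatedTowerTransformDecay
open Summit.RiemannHypothesis.RiemannHypothesis.Theorems.DensityLadderSeparatedTowerGaussian
open Summit.RiemannHypothesis.RiemannHypothesis.Theorems.DensityLadderSeparatedTowerGaussianReal
open Summit.RiemannHypothesis.RiemannHypothesis.Theorems.DensityLadderSeparatedTowerWindows
open Summit.RiemannHypothesis.RiemannHypothesis.Theorems.DensityLadderSeparatedTowerSchur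
open Summit.RiemannHypothesis.RiemannHypothesis.Theorems.DensityLadderSeparatedTowerTameFinite
open Summit.RiemannHypothesis.RiemannHypothesis.Theorems.DensityLadderSeparatedTowerUpperPieces
open Summit.RiemannHypothesis.RiemannHypothesis.Theorems.DensityLadderSeparatedTowerFarTail
open Summit.RiemannHypothesis.RiemannHypothesis.Theorems.DensityLadderSeparatedTowerUpperPointwise

/-- **UPPER half of stub S1.** [folklore] -/
theorem upper_bound {ι : Type} (m : ι → ℝ) (ρ : ι → ℂ) (hm0 : ∀ i, 0 ≤ m i)
    (hre01 : ∀ i, 0 ≤ (ρ i).re ∧ (ρ i).re ≤ 1)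
    {g B Ct M₂ Ca : ℝ} (hg : 0 < g) (hB : 0 ≤ B) (hCt : 0 ≤ Ct) (hM₂ : 0 ≤ M₂)
    (htowB : ∀ i, 1 / 2 < (ρ i).re → m i ≤ B)
    (hsep : ∀ i j : ι, 1 / 2 < (ρ i).re → 1 / 2 < (ρ j).re → i ≠ j → g ≤ |(ρ i).im - (ρ j).im|)
    (htame : ∀ t : ℝ, {i : ι | (ρ i).re ≤ 1 / 2 ∧ |(ρ i).im - t| ≤ 1}.Finite ∧
      (∑ᶠ i ∈ {i : ι | (ρ i).re ≤ 1 / 2 ∧ |(ρ i).im - t| ≤ 1}, m i) ≤ Ct * Real.log (|t| + 2))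
    (φ : ℝ → ℝ) (hφC2 : ContDiff ℝ 2 φ) (hφs : ∀ v, 1 ≤ |v| → φ v = 0) (hMφ : ∀ v, |φ v| ≤ 1)
    (hM₂φ : ∀ v, |deriv (deriv φ) v| ≤ M₂)
    (hS : ∀ η x : ℝ, 0 < η → η ≤ 1 / 2 → 3 ≤ x →
      ‖∑' i : ι, (m i : ℂ) * ((x : ℂ) ^ (ρ i) *
        ∫ v in (-1 : ℝ)..1, (φ v : ℂ) * ((1 : ℂ) + (η : ℂ) * (v : ℂ)) ^ (ρ i - 1))‖ ≤
        Ca * (x * Real.log x + Real.log x / η))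
    (hSum : ∀ η x : ℝ, 0 < η → η ≤ 1 / 2 → 3 ≤ x →
      Summable (fun i : ι ↦ m i * ‖(x : ℂ) ^ (ρ i) *
        ∫ v in (-1 : ℝ)..1, (φ v : ℂ) * ((1 : ℂ) + (η : ℂ) * (v : ℂ)) ^ (ρ i - 1)‖)) :
    ∃ Cup : ℝ, 0 < Cup ∧ ∀ T : ℝ, 3 ≤ T → ∀ F : Finset ι,
      (∀ i, i ∈ F ↔ 1 / 2 < (ρ i).re ∧ |(ρ i).im| ≤ T ^ 4) →
      ∫ u : ℝ, ‖∑ i ∈ F, (m i : ℂ) * (∫ v in (-1 : ℝ)..1, (φ v : ℂ) *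
          ((1 : ℂ) + ((1 / (4 * (T + 1)) : ℝ) : ℂ) * (v : ℂ)) ^ (ρ i - 1)) * cexp (ρ i * u)‖ ^ 2 *
        Real.exp (-(u - Real.log (4 * (T + 1))) ^ 2 / (2 * (2 / g) ^ 2)) ≤
      Cup * (4 * (T + 1)) ^ 2 * Real.log (4 * (T + 1)) ^ 2 := by
  classical
  -- constants
  set L : ℝ := 2 / g with hL
  have hL0 : 0 < L := by positivity
  set c₀ : ℝ := Real.sqrt (2 * π) * L with hc₀
  have hc₀0 : 0 < c₀ := by positivity
  set cS : ℝ := L ^ 2 / 2 with hcS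
  have hcS0 : 0 < cS := by positivity
  obtain ⟨K, hK0, hK⟩ := exists_window_gauss_log_le hcS0
  set CH : ℝ := (30 + 18 * M₂) with hCH
  have hCH0 : 0 < CH := by positivity
  set Kfar : ℝ := ∑' j : ℕ, (if j ≤ 1 then (0 : ℝ) else ((j : ℝ) + 2) ^ (3 / 4 : ℝ) / ((j : ℝ) - 1) ^ 2)
    with hKfar
  have hKfar0 : 0 ≤ Kfar := tsum_nonneg fun j ↦ by
    split_ifs
    · exact le_rfl
    · positivity
  set CR : ℝ := (4 * Ct + B * (1 / g + 1)) * (288 * M₂) * (2 * Kfar) with hCR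
  have hCR0 : 0 ≤ CR := by positivity
  set k₁ : ℝ := 2 * c₀ * Real.exp (2 * L ^ 2) +
    8 * L ^ 2 * (Real.sqrt (2 * π) * (Real.sqrt 2 * L) * Real.exp (4 * L ^ 2)) with hk₁
  set k₂ : ℝ := 2 * c₀ + 8 * L ^ 2 * (Real.sqrt (2 * π) * (Real.sqrt 2 * L)) with hk₂
  set κ₁ : ℝ := 6 * Ca ^ 2 * (k₁ + k₂) with hκ₁
  set κ₂ : ℝ := 192 * c₀ * Real.exp (L ^ 2 / 2) * Ct ^ 2 * K * CH with hκ₂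
  set κ₃ : ℝ := 3 * CR ^ 2 * c₀ * Real.exp (2 * L ^ 2) with hκ₃
  set κ₄ : ℝ := (3 * (B * (1 / g + 1) * (CH))) ^ 2 * c₀ with hκ₄
  have hk₁0 : 0 ≤ k₁ := by positivity
  have hk₂0 : 0 ≤ k₂ := by positivity
  have hκ₁0 : 0 ≤ κ₁ := by positivity
  have hκ₂0 : 0 ≤ κ₂ := by positivity
  have hκ₃0 : 0 ≤ κ₃ := by positivity
  have hκ₄0 : 0 ≤ κ₄ := by positivity
  refine ⟨κ₁ + κ₂ + κ₃ + κ₄ + 1, by positivity, fun T hT F hmemF ↦ ?_⟩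
  -- objects at height `T`
  set A : ℝ := 4 * (T + 1) with hA
  have hA0 : 0 < A := by positivity
  have hA16 : 16 ≤ A := by rw [hA]; linarith
  have hA2 : 2 ≤ A := by linarith
  have hη0 : 0 < 1 / A := by positivity
  have hη1 : 1 / A ≤ 1 / 2 := by rw [div_le_div_iff₀ hA0 (by norm_num)]; linarith
  set U : ℝ := Real.log A with hU
  have hU1 : 1 ≤ U := by
    rw [hU, ← Real.log_exp 1]
    exact Real.log_le_log (Real.exp_pos 1) (by have := Real.exp_one_lt_d9; linarith)
  have hU0 : 0 ≤ U := by linarith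
  have hAexp : Real.exp U = A := by rw [hU, Real.exp_log hA0]
  have hT9 : (9 : ℝ) ≤ T ^ 2 := by nlinarith only [hT]
  have hT4 : (81 : ℝ) ≤ T ^ 4 := by nlinarith only [hT9]
  have hT4A : T ^ 4 + 3 ≤ A ^ 4 := by
    have h1 : T ^ 2 ≤ A ^ 2 := by rw [hA]; nlinarith only [hT]
    have h2 : T ^ 4 ≤ A ^ 2 * T ^ 2 := by nlinarith only [h1, hT9]
    have h3 : A ^ 2 * T ^ 2 + 3 ≤ A ^ 4 := by
      have hA2sq : (256 : ℝ) ≤ A ^ 2 := by nlinarith only [hA16]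
      nlinarith only [h1, hA2sq, hT9]
    linarith only [h2, h3]
  have hlog_near : ∀ x : ℝ, 0 ≤ x → x ≤ T ^ 4 + 1 → Real.log (x + 2) ≤ 4 * U := by
    intro x hx0 hx
    calc Real.log (x + 2) ≤ Real.log (A ^ 4) := Real.log_le_log (by linarith) (by linarith)
      _ = 4 * U := by rw [Real.log_pow, hU]; norm_num
  -- the tame truncation
  have hAfin := finite_of_windows_finite (fun i ↦ (ρ i).im) (fun i ↦ (ρ i).re ≤ 1 / 2)
    (fun t ↦ (htame t).1) (T ^ 4)
  set Atm : Finset ι := hAfin.toFinset with hAtm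
  have hmemA : ∀ i, i ∈ Atm ↔ (ρ i).re ≤ 1 / 2 ∧ |(ρ i).im| ≤ T ^ 4 := fun i ↦ by
    rw [hAtm, Set.Finite.mem_toFinset]; rfl
  -- transforms
  set c : ι → ℂ := fun i ↦ ∫ v in (-1 : ℝ)..1, (φ v : ℂ) *
    ((1 : ℂ) + (((1 / A : ℝ)) : ℂ) * (v : ℂ)) ^ (ρ i - 1) with hc
  have hc4 : ∀ i, ‖c i‖ ≤ 4 := fun i ↦ by
    have h := norm_windowTransform_le φ hMφ hη0 hη1 (hre01 i).1 (hre01 i).2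
    rw [hc]; linarith
  have hcH : ∀ i, ‖c i‖ ≤ (if |((⌊(ρ i).im⌋ : ℤ) : ℝ)| ≤ A + 1 then (4 : ℝ)
      else 9 / 2 * M₂ * A ^ 2 / ((|((⌊(ρ i).im⌋ : ℤ) : ℝ)| - 1) ^ 2)) := fun i ↦
    norm_transform_le_profile φ hφC2 hφs hMφ hM₂ hM₂φ hA2 (hre01 i).1 (hre01 i).2
  have hcdec : ∀ i, T ^ 4 < |(ρ i).im| → ‖c i‖ ≤ 9 / 2 * M₂ * (4 * (T + 1)) ^ 2 / (ρ i).im ^ 2 := by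
    intro i hi
    have hγabs : 0 < |(ρ i).im| := by linarith
    have hγ : (ρ i).im ≠ 0 := abs_pos.1 hγabs
    have hρ0 : ρ i ≠ 0 := fun e ↦ hγ (by rw [e]; simp)
    have hρ1 : ρ i + 1 ≠ 0 := fun e ↦ hγ (by have := congrArg Complex.im e; simpa using this)
    have h := norm_windowTransform_le_decay φ hφC2 hφs hM₂φ hη0 hη1 (hre01 i).1 (hre01 i).2 hρ0 hρ1
    refine h.trans ?_
    have hρn : |(ρ i).im| ≤ ‖ρ i‖ := Complex.abs_im_le_norm _
    have hρn1 : |(ρ i).im| ≤ ‖ρ i + 1‖ := by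
      have := Complex.abs_im_le_norm (ρ i + 1); simpa using this
    have hprod : (ρ i).im ^ 2 ≤ ‖ρ i‖ * ‖ρ i + 1‖ := by
      rw [← sq_abs, sq]; exact mul_le_mul hρn hρn1 hγabs.le (norm_nonneg _)
    have e1 : 9 / 2 * M₂ / ((1 / A) ^ 2 * ‖ρ i‖ * ‖ρ i + 1‖) = 9 / 2 * M₂ * A ^ 2 / (‖ρ i‖ * ‖ρ i + 1‖) := by
      field_simp
    rw [e1, ← hA]
    exact div_le_div_of_nonneg_left (by positivity) (by positivity) hprod
  /- (s1) tower truncation sum -/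
  have hFtow : ∀ i ∈ F, 1 / 2 < (ρ i).re := fun i hi ↦ ((hmemF i).1 hi).1
  have hs1 : ∑ i ∈ F, m i * ‖c i‖ ≤ B * (1 / g + 1) * (CH * A) :=
    sum_profile_le F (fun i ↦ (ρ i).im) m (fun i ↦ ‖c i‖) hm0 hA2 hM₂ (by positivity)
      (fun i _ ↦ hcH i)
      (tower_window_mass_le (fun i ↦ (ρ i).im) m (fun i ↦ 1 / 2 < (ρ i).re) hg hB htowB
        (fun i j hi hj hij ↦ hsep i j hi hj hij) F hFtow)
  /- (s2) tame truncation sum -/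
  have hAtame : ∀ i ∈ Atm, (ρ i).re ≤ 1 / 2 := fun i hi ↦ ((hmemA i).1 hi).1
  have hwA : ∀ n : ℤ, ∑ i ∈ Atm.filter (fun i ↦ ⌊(ρ i).im⌋ = n), m i ≤ Ct * Real.log (|(n : ℝ)| + 2) :=
    tame_window_mass_le (fun i ↦ (ρ i).im) m hm0 (fun i ↦ (ρ i).re ≤ 1 / 2) htame Atm hAtame
  have hwA' : ∀ n : ℤ, ∑ i ∈ Atm.filter (fun i ↦ ⌊(ρ i).im⌋ = n), m i ≤ 4 * Ct * U := by
    intro n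
    by_cases hne : (Atm.filter (fun i ↦ ⌊(ρ i).im⌋ = n)).Nonempty
    · obtain ⟨i, hi⟩ := hne
      rw [Finset.mem_filter] at hi
      have hγi := ((hmemA i).1 hi.1).2
      have habs : |((n : ℝ))| ≤ T ^ 4 + 1 := by
        rw [← hi.2]
        have hfl := Int.floor_le ((ρ i).im); have hfl2 := Int.lt_floor_add_one ((ρ i).im)
        have h1 := abs_le.1 hγi
        rw [abs_le]; constructor <;> linarith
      have hl := hlog_near _ (abs_nonneg _) habs
      refine (hwA n).trans ?_
      have := mul_le_mul_of_nonneg_left hl hCt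
      linarith only [this]
    · rw [Finset.not_nonempty_iff_eq_empty.1 hne, Finset.sum_empty]; positivity
  have hs2 : ∑ i ∈ Atm, m i * ‖c i‖ ≤ 4 * Ct * U * (CH * A) :=
    sum_profile_le Atm (fun i ↦ (ρ i).im) m (fun i ↦ ‖c i‖) hm0 hA2 hM₂ (by positivity)
      (fun i _ ↦ hcH i) hwA'
  /- (s3) tame Schur sums -/
  have hs3 : ∀ i ∈ Atm, ∑ j ∈ Atm, m j * Real.exp (-(cS * ((ρ j).im - (ρ i).im) ^ 2)) ≤ 4 * Ct * K * U := by
    intro i hi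
    have h := tame_schur_sum_le Atm (fun j ↦ (ρ j).im) m hm0 hCt hcS0 hK hwA ((ρ i).im)
    refine h.trans ?_
    have hylog : Real.log (|(ρ i).im| + 2) ≤ 4 * U :=
      hlog_near _ (abs_nonneg _) (by have := ((hmemA i).1 hi).2; linarith)
    calc Ct * K * Real.log (|(ρ i).im| + 2) ≤ Ct * K * (4 * U) := by gcongr
      _ = 4 * Ct * K * U := by ring
  /- (s4) the far tail -/
  obtain ⟨hfarS, hfar⟩ := far_tail_le m ρ hm0 hCt hB hg hM₂ hT htame htowB hsep (fun i ↦ ‖c i‖)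
    (fun i ↦ norm_nonneg _) hcdec
  rw [← hKfar, ← hCR] at hfar
  /- pointwise majorant -/
  set Z : ℝ → ℂ := fun u ↦ ∑ i ∈ F, (m i : ℂ) * c i * cexp (ρ i * u) with hZ
  set ZA : ℝ → ℂ := fun u ↦ ∑ i ∈ Atm, (m i : ℂ) * c i * cexp (ρ i * u) with hZA
  set Z₀ : ℝ := 3 * (B * (1 / g + 1) * (CH * A)) with hZ₀
  have hZ₀0 : 0 ≤ Z₀ := by positivity
  -- hypotheses of the pointwise majorant
  have hdisj : Disjoint F Atm := by
    rw [Finset.disjoint_left]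
    intro i hiF hiA
    have h1 := ((hmemF i).1 hiF).1; have h2 := ((hmemA i).1 hiA).1; linarith
  have hcover : ∀ i, i ∉ F → i ∉ Atm → T ^ 4 < |(ρ i).im| := by
    intro i hiF hiA
    by_contra hle
    rw [not_lt] at hle
    rcases le_or_gt ((ρ i).re) (1 / 2) with h | h
    · exact hiA ((hmemA i).2 ⟨h, hle⟩)
    · exact hiF ((hmemF i).2 ⟨h, hle⟩)
  have hS' : ∀ x : ℝ, 3 ≤ x →
      ‖∑' i : ι, (m i : ℂ) * ((x : ℂ) ^ (ρ i) * c i)‖ ≤ Ca * (x * Real.log x + A * Real.log x) := by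
    intro x hx
    have h := hS (1 / A) x hη0 hη1 hx
    have e : Ca * (x * Real.log x + Real.log x / (1 / A)) = Ca * (x * Real.log x + A * Real.log x) := by
      rw [div_div_eq_mul_div, div_one]; ring
    rw [e] at h
    exact h
  have hSum' : ∀ x : ℝ, 3 ≤ x → Summable (fun i : ι ↦ m i * ‖(x : ℂ) ^ (ρ i) * c i‖) :=
    fun x hx ↦ hSum (1 / A) x hη0 hη1 hx
  -- the majorant `Mj`
  set Mj : ℝ → ℝ := fun u ↦ 6 * Ca ^ 2 * (u ^ 2 * Real.exp (2 * u) + A ^ 2 * u ^ 2) +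
    3 * ‖ZA u‖ ^ 2 + 3 * (Real.exp (2 * u) * CR ^ 2) + Z₀ ^ 2 with hMj
  have hpt : ∀ u : ℝ, ‖Z u‖ ^ 2 ≤ Mj u := fun u ↦
    pointwise_majorant m ρ c hm0 hre01 F Atm hdisj hcover hs1 hfarS hfar hS' hSum' u
  /- integrability of the majorant pieces and their integrals -/
  set G : ℝ → ℝ := fun u ↦ Real.exp (-(u - U) ^ 2 / (2 * L ^ 2)) with hG
  have hG0 : ∀ u, 0 < G u := fun u ↦ Real.exp_pos _
  obtain ⟨hI2int, hI2⟩ := integral_sq_mul_exp_mul_gaussian_le 2 hL0 U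
  obtain ⟨hI0int, hI0⟩ := integral_sq_mul_exp_mul_gaussian_le 0 hL0 U
  have hE2 := integral_exp_mul_gaussian 2 hL0 U
  have hE2int := integrable_exp_mul_gaussian 2 hL0 U
  have hE0 := integral_exp_mul_gaussian 0 hL0 U
  have hE0int := integrable_exp_mul_gaussian 0 hL0 U
  -- `ZA` is continuous and `‖ZA‖² G` integrable
  have hZAc : Continuous ZA := by
    rw [hZA]
    refine continuous_finsetSum _ fun i _ ↦ ?_
    exact continuous_const.mul (Complex.continuous_exp.comp (continuous_const.mul Complex.continuous_ofReal))
  have hZAbound : ∀ u, ‖ZA u‖ ^ 2 * G u ≤ (4 * Ct * U * (CH * A)) ^ 2 *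
      (2 * (Real.exp (0 * u) * G u) + 2 * (Real.exp (2 * u) * G u)) := by
    intro u
    have hn : ‖ZA u‖ ≤ (∑ i ∈ Atm, m i * ‖c i‖) * (1 + Real.exp u) := by
      calc ‖ZA u‖ ≤ ∑ i ∈ Atm, ‖(m i : ℂ) * c i * cexp (ρ i * u)‖ := norm_sum_le _ _
        _ ≤ ∑ i ∈ Atm, m i * ‖c i‖ * (1 + Real.exp u) := Finset.sum_le_sum fun i _ ↦ by
            rw [norm_mul, norm_mul, Complex.norm_real, Real.norm_of_nonneg (hm0 i), Complex.norm_exp]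
            refine mul_le_mul_of_nonneg_left ?_ (mul_nonneg (hm0 i) (norm_nonneg _))
            have hre : (ρ i * (u : ℂ)).re = (ρ i).re * u := by simp
            rw [hre]
            have hupos := Real.exp_pos u
            rcases le_or_gt u 0 with hu | hu
            · calc Real.exp ((ρ i).re * u) ≤ Real.exp 0 :=
                    Real.exp_le_exp.2 (mul_nonpos_of_nonneg_of_nonpos (hre01 i).1 hu)
                _ ≤ 1 + Real.exp u := by rw [Real.exp_zero]; linarith only [hupos]
            · calc Real.exp ((ρ i).re * u) ≤ Real.exp u :=
                    Real.exp_le_exp.2 (by nlinarith only [(hre01 i).2, hu])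
                _ ≤ 1 + Real.exp u := by linarith only [hupos]
        _ = (∑ i ∈ Atm, m i * ‖c i‖) * (1 + Real.exp u) := by rw [Finset.sum_mul]
    obtain ⟨S2, hS2⟩ : ∃ S2 : ℝ, S2 = 4 * Ct * U * (CH * A) := ⟨_, rfl⟩
    have hS20 : 0 ≤ S2 := by rw [hS2]; positivity
    rw [← hS2] at hs2 ⊢
    have hn2 : ‖ZA u‖ ≤ S2 * (1 + Real.exp u) := hn.trans (mul_le_mul_of_nonneg_right hs2 (by positivity))
    have hsq : ‖ZA u‖ ^ 2 ≤ S2 ^ 2 * (1 + Real.exp u) ^ 2 := by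
      rw [← mul_pow]; exact pow_le_pow_left₀ (norm_nonneg _) hn2 2
    have h2 : (1 + Real.exp u) ^ 2 ≤ 2 * (1 + Real.exp (2 * u)) := by
      have : (1 + Real.exp u) ^ 2 ≤ 2 * (1 ^ 2 + Real.exp u ^ 2) := by
        nlinarith only [sq_nonneg (1 - Real.exp u)]
      rw [show Real.exp (2 * u) = Real.exp u ^ 2 by rw [← Real.exp_nat_mul]; ring_nf]
      linarith only [this]
    have hGu := (hG0 u).le
    rw [zero_mul, Real.exp_zero, one_mul]
    calc ‖ZA u‖ ^ 2 * G u ≤ (S2 ^ 2 * (2 * (1 + Real.exp (2 * u)))) * G u := by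
          refine mul_le_mul_of_nonneg_right ?_ hGu
          exact hsq.trans (mul_le_mul_of_nonneg_left h2 (sq_nonneg _))
      _ = S2 ^ 2 * (2 * G u + 2 * (Real.exp (2 * u) * G u)) := by ring
  have hdom : Integrable (fun u ↦ (4 * Ct * U * (CH * A)) ^ 2 *
      (2 * (Real.exp (0 * u) * G u) + 2 * (Real.exp (2 * u) * G u))) := by
    have h := ((hE0int.const_mul 2).add (hE2int.const_mul 2)).const_mul ((4 * Ct * U * (CH * A)) ^ 2)
    refine h.congr (Eventually.of_forall fun u ↦ ?_)
    simp only [Pi.add_apply, hG]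
  have hZAint : Integrable (fun u ↦ ‖ZA u‖ ^ 2 * G u) := by
    refine Integrable.mono' hdom ((hZAc.norm.pow 2).mul (by rw [hG]; fun_prop)).aestronglyMeasurable
      (Eventually.of_forall fun u ↦ ?_)
    rw [Real.norm_of_nonneg (mul_nonneg (sq_nonneg _) (hG0 u).le)]
    exact hZAbound u
  -- the tame mean square (finite expansion + Schur)
  have hZAval : ∫ u, ‖ZA u‖ ^ 2 * G u ≤ κ₂ / 3 * A ^ 2 * U ^ 2 := by
    have h := tame_meanSquare_le m ρ c hm0 Atm hAtame (fun i ↦ (hre01 i).1) hc4 hL0 hU0 hs2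
      (by positivity : (0 : ℝ) ≤ 4 * Ct * K * U) hs3
    have e : Real.sqrt (2 * π) * L * Real.exp (U + L ^ 2 / 2) * (4 * (4 * Ct * K * U)) *
        (4 * Ct * U * (CH * A)) = κ₂ / 3 * A ^ 2 * U ^ 2 := by
      rw [hκ₂, hc₀, Real.exp_add, hAexp]; ring
    rw [e] at h
    exact h
  -- integrability of `Mj G` and the integral bound
  have hMjG : ∀ u, Mj u * G u = 6 * Ca ^ 2 * (u ^ 2 * Real.exp (2 * u) * G u) +
      6 * Ca ^ 2 * A ^ 2 * (u ^ 2 * Real.exp (0 * u) * G u) + 3 * (‖ZA u‖ ^ 2 * G u) +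
      3 * CR ^ 2 * (Real.exp (2 * u) * G u) + Z₀ ^ 2 * (Real.exp (0 * u) * G u) := by
    intro u; rw [hMj]; simp only; rw [zero_mul, Real.exp_zero]; ring
  have hMjint : Integrable (fun u ↦ Mj u * G u) := by
    have h : Integrable (fun u ↦ 6 * Ca ^ 2 * (u ^ 2 * Real.exp (2 * u) * G u) +
        6 * Ca ^ 2 * A ^ 2 * (u ^ 2 * Real.exp (0 * u) * G u) + 3 * (‖ZA u‖ ^ 2 * G u) +
        3 * CR ^ 2 * (Real.exp (2 * u) * G u) + Z₀ ^ 2 * (Real.exp (0 * u) * G u)) :=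
      ((((hI2int.const_mul _).add (hI0int.const_mul _)).add (hZAint.const_mul _)).add
        (hE2int.const_mul _)).add (hE0int.const_mul _)
    exact h.congr (Eventually.of_forall fun u ↦ (hMjG u).symm)
  have hJle : ∫ u, ‖Z u‖ ^ 2 * G u ≤ ∫ u, Mj u * G u :=
    integral_mono_of_nonneg (Eventually.of_forall fun u ↦ mul_nonneg (sq_nonneg _) (hG0 u).le) hMjint
      (Eventually.of_forall fun u ↦ mul_le_mul_of_nonneg_right (hpt u) (hG0 u).le)
  have hMjval : ∫ u, Mj u * G u ≤ (κ₁ + κ₂ + κ₃ + κ₄) * A ^ 2 * U ^ 2 := by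
    rw [integral_congr_ae (Eventually.of_forall hMjG)]
    rw [integral_add, integral_add, integral_add, integral_add, integral_const_mul, integral_const_mul,
      integral_const_mul, integral_const_mul, integral_const_mul]
    rotate_left
    · exact hI2int.const_mul _
    · exact hI0int.const_mul _
    · exact (hI2int.const_mul _).add (hI0int.const_mul _)
    · exact hZAint.const_mul _
    · exact ((hI2int.const_mul _).add (hI0int.const_mul _)).add (hZAint.const_mul _)
    · exact hE2int.const_mul _
    · exact (((hI2int.const_mul _).add (hI0int.const_mul _)).add (hZAint.const_mul _)).add (hE2int.const_mul _)
    · exact hE0int.const_mul _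
    -- the five integrals
    have e2U : Real.exp (2 * U + 2 ^ 2 * L ^ 2 / 2) = A ^ 2 * Real.exp (2 * L ^ 2) := by
      rw [show 2 * U + 2 ^ 2 * L ^ 2 / 2 = 2 * U + 2 * L ^ 2 by ring, Real.exp_add, ← hAexp,
        ← Real.exp_nat_mul]; ring_nf
    have e2U' : Real.exp (2 * U + 2 ^ 2 * (Real.sqrt 2 * L) ^ 2 / 2) = A ^ 2 * Real.exp (4 * L ^ 2) := by
      have : (Real.sqrt 2 * L) ^ 2 = 2 * L ^ 2 := by rw [mul_pow, Real.sq_sqrt (by norm_num)]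
      rw [this, show 2 * U + 2 ^ 2 * (2 * L ^ 2) / 2 = 2 * U + 4 * L ^ 2 by ring, Real.exp_add, ← hAexp,
        ← Real.exp_nat_mul]; ring_nf
    have h1 : ∫ u, u ^ 2 * Real.exp (2 * u) * G u ≤ A ^ 2 * U ^ 2 * k₁ := by
      refine hI2.trans ?_
      rw [e2U, e2U', hk₁, hc₀]
      have hsq2 : 0 ≤ 8 * L ^ 2 * (Real.sqrt (2 * π) * (Real.sqrt 2 * L) * Real.exp (4 * L ^ 2)) := by positivity
      have hU2 : (0:ℝ) ≤ U ^ 2 - 1 := by nlinarith only [hU1]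
      have hx := mul_nonneg (mul_nonneg (sq_nonneg A) hsq2) hU2
      nlinarith only [hx, sq_nonneg A, sq_nonneg U]
    have h2 : ∫ u, u ^ 2 * Real.exp (0 * u) * G u ≤ U ^ 2 * k₂ := by
      refine hI0.trans ?_
      simp only [zero_mul, zero_pow two_ne_zero, zero_div, add_zero, Real.exp_zero, mul_one]
      rw [hk₂, hc₀]
      have hsq2 : 0 ≤ 8 * L ^ 2 * (Real.sqrt (2 * π) * (Real.sqrt 2 * L)) := by positivity
      have hU2 : (0:ℝ) ≤ U ^ 2 - 1 := by nlinarith only [hU1]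
      have hx := mul_nonneg hsq2 hU2
      nlinarith only [hx]
    have h3 : ∫ u, Real.exp (2 * u) * G u = c₀ * Real.exp (2 * L ^ 2) * A ^ 2 := by
      rw [hG]; simp only; rw [hE2, e2U, hc₀]; ring
    have h4 : ∫ u, Real.exp (0 * u) * G u = c₀ := by
      rw [hG]; simp only; rw [hE0]; simp [hc₀]
    rw [h3, h4]
    have hA2' : 1 ≤ A ^ 2 := by nlinarith only [hA16]
    have hU2 : 1 ≤ U ^ 2 := by nlinarith only [hU1]
    have hAU : 0 ≤ A ^ 2 * U ^ 2 := by positivity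
    have t1 : 6 * Ca ^ 2 * ∫ u, u ^ 2 * Real.exp (2 * u) * G u ≤ 6 * Ca ^ 2 * (A ^ 2 * U ^ 2 * k₁) :=
      mul_le_mul_of_nonneg_left h1 (by positivity)
    have t2 : 6 * Ca ^ 2 * A ^ 2 * ∫ u, u ^ 2 * Real.exp (0 * u) * G u ≤ 6 * Ca ^ 2 * A ^ 2 * (U ^ 2 * k₂) :=
      mul_le_mul_of_nonneg_left h2 (by positivity)
    have t3 : 3 * ∫ u, ‖ZA u‖ ^ 2 * G u ≤ κ₂ * (A ^ 2 * U ^ 2) := by linarith only [hZAval]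
    have t4 : 3 * CR ^ 2 * (c₀ * Real.exp (2 * L ^ 2) * A ^ 2) ≤ κ₃ * (A ^ 2 * U ^ 2) := by
      rw [hκ₃]
      have : 3 * CR ^ 2 * (c₀ * Real.exp (2 * L ^ 2) * A ^ 2) = (3 * CR ^ 2 * c₀ * Real.exp (2 * L ^ 2)) * (A ^ 2 * 1) := by ring
      rw [this]
      exact mul_le_mul_of_nonneg_left (mul_le_mul_of_nonneg_left hU2 (sq_nonneg A)) hκ₃0
    have t5 : Z₀ ^ 2 * c₀ ≤ κ₄ * (A ^ 2 * U ^ 2) := by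
      have : Z₀ ^ 2 * c₀ = κ₄ * (A ^ 2 * 1) := by rw [hZ₀, hκ₄]; ring
      rw [this]
      exact mul_le_mul_of_nonneg_left (mul_le_mul_of_nonneg_left hU2 (sq_nonneg A)) hκ₄0
    have e1 : 6 * Ca ^ 2 * (A ^ 2 * U ^ 2 * k₁) + 6 * Ca ^ 2 * A ^ 2 * (U ^ 2 * k₂) = κ₁ * (A ^ 2 * U ^ 2) := by
      rw [hκ₁]; ring
    linarith only [t1, t2, t3, t4, t5, e1]
  -- conclude
  have hfinal : ∫ u, ‖Z u‖ ^ 2 * G u ≤ (κ₁ + κ₂ + κ₃ + κ₄ + 1) * A ^ 2 * U ^ 2 := by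
    have := hJle.trans hMjval
    have hAU : 0 ≤ A ^ 2 * U ^ 2 := by positivity
    nlinarith only [this, hAU]
  exact hfinal

end Summit.RiemannHypothesis.RiemannHypothesis.Theorems.DensityLadderSeparatedTowerUpperBound

end
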